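import Mathlib
import Summits.ValiantsHypothesis.ValiantsHypothesis.Theorems.LacunarySymmetroidMatrixDescartesDefiniteMomentsKit
import Summits.ValiantsHypothesis.ValiantsHypothesis.Theorems.LacunarySymmetroidMatrixDescartesDefiniteMomentsDescartes

/-!
# `MatrixDescartes` (stmt-ValiantsHypothesis-18050) — the DEFINITE-MOMENTS LAW, IV: the Rayleigh K-nomial of a
# semidefinite sign word (coefficients, block sign pattern, zero budget, signs near `0⁺` and `+∞`)

HONEST FRAMING.  Cell `pub-symmetroid`, seat `val-sym-mdr-p2` (gen 14); helper file `--supports` the crux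
`Theses.LacunarySymmetroid.MatrixDescartes`, NO closure claim; scalar tools for the sign-word form of the
definite-moments law (`…DefiniteMomentsWordData`, `…DefiniteMomentsWord`).  Nothing here bears on the crux in its
window, on `stub_twoSided`, on `DoorA26`/`DoorA34`, registers, or `VP ≠ VNP`.

SETTING.  `F(x) = ∑ₖ x^{dₖ} Sₖ`, real symmetric `ι × ι` letters, natural exponents; a SEMIDEFINITE SIGN WORD given by a
monotone block index `β : ℕ → ℕ` on exponents with `(−1)^{β(dₖ)} Sₖ ⪰ 0` (block `0` positive semidefinite, block `1`
negative semidefinite, …).  For a vector `v` the Rayleigh `K`-nomial is `P_v = ∑ₖ (vᵀSₖv)·X^{dₖ}`, whose values are the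
Rayleigh form `f_v(x) = vᵀF(x)v` (`eval_rayleighPoly`).  CONTENT: its coefficients follow the block sign pattern
(`rayleighPoly_signPattern`), hence (Kit `card_posZeros_add_le_of_signPattern`, Descartes) every finite set of positive
zeros of `f_v` has at most `β(deg P_v) − β(trailing degree of P_v)` elements — «last visible block minus first visible
block» (`rayleigh_word_budget`); and `f_v` has the sign `(−1)^{β(trailing degree)}` near `0⁺` and `(−1)^{β(deg)}` near
`+∞` (`rayleigh_word_near_zero`, `rayleigh_word_atTop`).  [folklore]; axioms `propext`, `Classical.choice`, `Quot.sound`.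
-/

-- layout Summits/ValiantsHypothesis/ValiantsHypothesis forces the duplicated namespace component
set_option linter.dupNamespace false

namespace Summit.ValiantsHypothesis.ValiantsHypothesis.Theorems.LacunarySymmetroidMatrixDescartes

open Polynomial Matrix Finset
open scoped BigOperators

namespace DefiniteMoments

section WordScalar

variable {ι κ : Type} [Fintype ι] [Fintype κ]

/-! ## §1 The Rayleigh K-nomial of a sign word: coefficients, sign pattern, budget, end signs -/

/-- Coefficients of the Rayleigh `K`-nomial `∑ₖ (vᵀSₖv) X^{dₖ}`. [folklore] -/
theorem coeff_rayleighPoly (d : κ → ℕ) (S : κ → Matrix ι ι ℝ) (v : ι → ℝ) (n : ℕ) :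
    (∑ k, C (v ⬝ᵥ (S k *ᵥ v)) * (X : ℝ[X]) ^ d k).coeff n = ∑ k, if n = d k then v ⬝ᵥ (S k *ᵥ v) else 0 := by
  rw [Polynomial.finsetSum_coeff]
  exact Finset.sum_congr rfl fun k _ => by rw [Polynomial.coeff_C_mul_X_pow]

/-- **Block sign pattern of the Rayleigh coefficients**: if `(−1)^{β(dₖ)} Sₖ ⪰ 0` for every letter then
`0 ≤ (−1)^{β n}·[Xⁿ]P_v` for every `n`. [folklore] -/
theorem rayleighPoly_signPattern (d : κ → ℕ) (S : κ → Matrix ι ι ℝ) (β : ℕ → ℕ)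
    (hsign : ∀ k, (((-1 : ℝ) ^ β (d k)) • S k).PosSemidef) (v : ι → ℝ) (n : ℕ) :
    0 ≤ (-1 : ℝ) ^ β n * (∑ k, C (v ⬝ᵥ (S k *ᵥ v)) * (X : ℝ[X]) ^ d k).coeff n := by
  rw [coeff_rayleighPoly, Finset.mul_sum]
  refine Finset.sum_nonneg fun k _ => ?_
  split_ifs with h
  · rw [h]
    have h1 := (hsign k).dotProduct_mulVec_nonneg v
    rwa [star_trivial, Matrix.smul_mulVec, dotProduct_smul, smul_eq_mul] at h1
  · rw [mul_zero]

/-- The Rayleigh `K`-nomial of a vector whose Rayleigh form is non-zero somewhere is a non-zero polynomial. [folklore] -/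
theorem rayleighPoly_ne_zero (d : κ → ℕ) (S : κ → Matrix ι ι ℝ) (v : ι → ℝ) {x₀ : ℝ}
    (hx₀ : v ⬝ᵥ ((∑ k, x₀ ^ d k • S k) *ᵥ v) ≠ 0) : (∑ k, C (v ⬝ᵥ (S k *ᵥ v)) * (X : ℝ[X]) ^ d k) ≠ 0 := by
  intro h
  apply hx₀
  rw [← eval_rayleighPoly, h, Polynomial.eval_zero]

/-- **Budget of a sign word's Rayleigh form**: every finite set of positive zeros of `f_v` has at most
`β(deg P_v) − β(trailing degree of P_v)` elements — the last visible block minus the first visible block.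
[folklore] -/
theorem rayleigh_word_budget (d : κ → ℕ) (S : κ → Matrix ι ι ℝ) (β : ℕ → ℕ) (hβ : Monotone β)
    (hsign : ∀ k, (((-1 : ℝ) ^ β (d k)) • S k).PosSemidef) (v : ι → ℝ) {x₀ : ℝ}
    (hx₀ : v ⬝ᵥ ((∑ k, x₀ ^ d k • S k) *ᵥ v) ≠ 0) (T : Finset ℝ)
    (hT : ∀ r ∈ T, 0 < r ∧ v ⬝ᵥ ((∑ k, r ^ d k • S k) *ᵥ v) = 0) :
    T.card + β (∑ k, C (v ⬝ᵥ (S k *ᵥ v)) * (X : ℝ[X]) ^ d k).natTrailingDegree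
      ≤ β (∑ k, C (v ⬝ᵥ (S k *ᵥ v)) * (X : ℝ[X]) ^ d k).natDegree := by
  set P := ∑ k, C (v ⬝ᵥ (S k *ᵥ v)) * (X : ℝ[X]) ^ d k with hP
  have hP0 : P ≠ 0 := rayleighPoly_ne_zero d S v hx₀
  refine card_posZeros_add_le_of_signPattern β hβ P hP0 (rayleighPoly_signPattern d S β hsign v) _
    (fun n hn => hβ (Polynomial.natTrailingDegree_le_of_mem_supp n hn)) T fun r hr => ⟨(hT r hr).1, ?_⟩
  rw [hP, eval_rayleighPoly]
  exact (hT r hr).2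

/-- **Sign of a sign word's Rayleigh form near `0⁺`**: `(−1)^{β(trailing degree)}·f_v > 0` on some `(0, δ)`. [folklore] -/
theorem rayleigh_word_near_zero (d : κ → ℕ) (S : κ → Matrix ι ι ℝ) (β : ℕ → ℕ)
    (hsign : ∀ k, (((-1 : ℝ) ^ β (d k)) • S k).PosSemidef) (v : ι → ℝ) {x₀ : ℝ}
    (hx₀ : v ⬝ᵥ ((∑ k, x₀ ^ d k • S k) *ᵥ v) ≠ 0) :
    ∃ δ : ℝ, 0 < δ ∧ ∀ x : ℝ, 0 < x → x < δ →
      0 < (-1 : ℝ) ^ β (∑ k, C (v ⬝ᵥ (S k *ᵥ v)) * (X : ℝ[X]) ^ d k).natTrailingDegree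
        * (v ⬝ᵥ ((∑ k, x ^ d k • S k) *ᵥ v)) := by
  set P := ∑ k, C (v ⬝ᵥ (S k *ᵥ v)) * (X : ℝ[X]) ^ d k with hP
  have hP0 : P ≠ 0 := rayleighPoly_ne_zero d S v hx₀
  have htc : 0 < (-1 : ℝ) ^ β P.natTrailingDegree * P.trailingCoeff := by
    have h1 := rayleighPoly_signPattern d S β hsign v P.natTrailingDegree
    have h2 : P.trailingCoeff ≠ 0 := Polynomial.trailingCoeff_nonzero_iff_nonzero.2 hP0
    refine lt_of_le_of_ne h1 (Ne.symm (mul_ne_zero (pow_ne_zero _ (by norm_num)) h2))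
  obtain ⟨δ, hδ, h⟩ := eventually_pos_near_zero P _ htc
  refine ⟨δ, hδ, fun x hx hxδ => ?_⟩
  rw [← eval_rayleighPoly]
  exact h x hx hxδ

/-- **Sign of a sign word's Rayleigh form near `+∞`**: `(−1)^{β(deg)}·f_v > 0` on some `(M, ∞)`. [folklore] -/
theorem rayleigh_word_atTop (d : κ → ℕ) (S : κ → Matrix ι ι ℝ) (β : ℕ → ℕ)
    (hsign : ∀ k, (((-1 : ℝ) ^ β (d k)) • S k).PosSemidef) (v : ι → ℝ) {x₀ : ℝ}
    (hx₀ : v ⬝ᵥ ((∑ k, x₀ ^ d k • S k) *ᵥ v) ≠ 0) :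
    ∃ M : ℝ, 0 < M ∧ ∀ x : ℝ, M < x →
      0 < (-1 : ℝ) ^ β (∑ k, C (v ⬝ᵥ (S k *ᵥ v)) * (X : ℝ[X]) ^ d k).natDegree
        * (v ⬝ᵥ ((∑ k, x ^ d k • S k) *ᵥ v)) := by
  set P := ∑ k, C (v ⬝ᵥ (S k *ᵥ v)) * (X : ℝ[X]) ^ d k with hP
  have hP0 : P ≠ 0 := rayleighPoly_ne_zero d S v hx₀
  have hlc : 0 < (-1 : ℝ) ^ β P.natDegree * P.leadingCoeff := by
    have h1 := rayleighPoly_signPattern d S β hsign v P.natDegree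
    have h2 : P.leadingCoeff ≠ 0 := Polynomial.leadingCoeff_ne_zero.2 hP0
    exact lt_of_le_of_ne h1 (Ne.symm (mul_ne_zero (pow_ne_zero _ (by norm_num)) h2))
  obtain ⟨M, hM, h⟩ := eventually_pos_atTop P _ hlc
  refine ⟨M, hM, fun x hx => ?_⟩
  rw [← eval_rayleighPoly]
  exact h x hx


/-! ## §2 Sign bookkeeping -/

/-- Values of opposite alternating signs multiply to a negative number. [folklore] -/
theorem mul_neg_of_alt {a b : ℝ} (m : ℕ) (ha : 0 < (-1 : ℝ) ^ m * a) (hb : 0 < (-1 : ℝ) ^ (m + 1) * b) :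
    a * b < 0 := by
  rw [pow_succ] at hb
  rcases neg_one_pow_eq_or ℝ m with h | h <;> rw [h] at ha hb <;> nlinarith

end WordScalar

end DefiniteMoments

end Summit.ValiantsHypothesis.ValiantsHypothesis.Theorems.LacunarySymmetroidMatrixDescartes
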